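import Summits.ABC.StewartYu.PadicG3SupplyHalfSharp
import Summits.ABC.StewartYu.PadicG3RecordR2
import HarnessLib

/-!
# Cell abc-stewartyu, crux `Y07Odd` (stmt-ABC-19658), line `gen3-slab-odd`: SLOT CEILINGS of the frame's closed forms over an abstract schedule
# (generic layer, part 2a): positivity and logarithms of `M0C`, `KC`, `1 + U·P·MhCs`, `AmaxS₂`, `PmaxS₂`, `UcardS₂`, `XbC`, with `ν(H)` SYMBOLIC

`Summits/ABC/StewartYu/PadicG3OddCeilings.lean` — cell `abc-stewartyu` (HOME `run/shared/lean/pub/abc-stewartyu/`), seat p5 (g4).  Theorems only; no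
named fact; no numbers.  These are the slots the instantiations (p1 g8: `sched1b 1`, `Z = G·X·L`; p3-g7: `schedVb 1`, `Zp`) bound in their currencies
(`Nat.lcmUpto H` is kept symbolic: use `NWPi.log_lcmUpto_le`, `ψ(H) ≤ (23/20)H`):
`BwP_pos`, `one_le_KC`, `one_le_PmaxS₂`, `log_M0C_le'` (`≤ log 2 + (Ŝ−lev)t₀·log 2 + t₀·log ν(H) + H/e + L₀·(1 + log(1 + 2^{Ŝ−lev}|x|/H))`),
`log_KC_le` (`≤ log 2 + log U + log P + log M0C + |t|·log max(1,XbC) + 2 log monDen(α, L|x|)`), `log_one_add_UPMhCs_le`, `log_AmaxS₂_eq`, `XbSS₂_cast`,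
`log_PmaxS₂_le`, `log_UcardS₂_eq`, `two_sideS₂_add_one_le`, `log_max_one_XbC_le`.  (`one_le_M0C`, `one_le_UcardS₂` are p3-g7's in `PadicG3VbSizes`;
private copies here.)

WHAT THIS IS NOT: the families (`PadicG3OddLines`); no crux moves.

References: Yu. V. Nesterenko, LNM 1819 (2003) §3.1–§3.4 (3.8), (3.26), §4.2 (4.31), §4.3 (4.41).
-/

noncomputable section

open NormedSpace Finset Polynomial
open Literature.NumberTheory.Transcendental
open Literature.NumberTheory.Transcendental.PadicCW77 (condExp)
open Literature.NumberTheory.Transcendental.CW77.Setup (Tau tauNorm)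
open scoped Nat

namespace Summit.ABC.StewartYu

namespace G3Setup

variable {p : ℕ} [Fact p.Prime] (S : G3Setup p) (Sc : G3Sched S.n)

/-! ### Positivity of the closed forms -/

omit S in
/-- `0 < BwP`. [folklore] -/
theorem BwP_pos (L₀ m : ℕ) : 0 < BwP (p := p) L₀ m := by
  have hp : (0 : ℝ) < p := by exact_mod_cast (Fact.out : p.Prime).pos
  unfold BwP; positivity

omit [Fact p.Prime] S in
/-- `1 ≤ M0C` (local copy; the public one is p3-g7's `PadicG3VbSizes.one_le_M0C`). [folklore] -/
private theorem one_le_M0C_aux (L₀ H Sh lev : ℕ) (x : ℤ) (t₀ : ℕ) : (1 : ℤ) ≤ M0C L₀ H Sh lev x t₀ := by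
  unfold M0C
  refine Int.one_le_ceil_iff.mpr ?_
  have hb : (1 : ℝ) ≤ Real.exp 1 * (1 + |((2 ^ (Sh - lev) * x : ℤ) : ℝ)| / H) := by
    have : (1 : ℝ) ≤ Real.exp 1 := Real.one_le_exp zero_le_one
    have : (0 : ℝ) ≤ |((2 ^ (Sh - lev) * x : ℤ) : ℝ)| / H := by positivity
    nlinarith
  have h2 : (1 : ℝ) ≤ (2 : ℝ) ^ ((Sh - lev) * t₀) := one_le_pow₀ (by norm_num)
  have h3 : (1 : ℝ) ≤ (Nat.lcmUpto H : ℝ) ^ t₀ := one_le_pow₀ (by exact_mod_cast Nat.lcmUpto_pos H)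
  have h4 : (1 : ℝ) ≤ Real.exp (H / Real.exp 1) := Real.one_le_exp (by positivity)
  have h5 : (1 : ℝ) ≤ (Real.exp 1 * (1 + |((2 ^ (Sh - lev) * x : ℤ) : ℝ)| / H)) ^ L₀ := one_le_pow₀ hb
  have h6 := one_le_mul_of_one_le_of_one_le h2 (one_le_mul_of_one_le_of_one_le h3 (one_le_mul_of_one_le_of_one_le h4 h5))
  linarith

/-- `1 ≤ KC` for `P ≥ 0`. [folklore] -/
theorem one_le_KC (U : ℕ) {P : ℤ} (hP : 0 ≤ P) (L₀ H Sh lev : ℕ) (L : Fin S.n → ℕ) (x : ℤ) (τ : Tau S.n) :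
    1 ≤ S.KC U P L₀ H Sh lev L x τ := by
  unfold KC
  have hM : (0 : ℝ) ≤ M0C L₀ H Sh lev x τ.1 := by
    have : (0 : ℤ) ≤ M0C L₀ H Sh lev x τ.1 := le_trans zero_le_one (one_le_M0C_aux L₀ H Sh lev x τ.1)
    exact_mod_cast this
  have hX : (0 : ℝ) ≤ S.XbC L := by
    have : (0 : ℤ) ≤ S.XbC L := by
      unfold XbC; exact mul_nonneg (by norm_num) (mul_nonneg (sum_nonneg fun j _ => abs_nonneg _) (sum_nonneg fun j _ => by positivity))
    exact_mod_cast this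
  have hP' : (0 : ℝ) ≤ P := by exact_mod_cast hP
  have : (0 : ℝ) ≤ (U : ℝ) * P * ((M0C L₀ H Sh lev x τ.1 : ℝ) * (S.XbC L : ℝ) ^ (∑ k, τ.2 k) * ((MonomialDen.monDen S.α (S.boxExpG L x) : ℝ)) ^ 2) := by
    positivity
  linarith

/-- `1 ≤ UcardS₂` (local copy; public: `PadicG3VbSizes.one_le_UcardS₂`). [folklore] -/
private theorem one_le_UcardS₂_aux : 1 ≤ S.UcardS₂ Sc := by
  unfold UcardS₂
  exact one_le_mul (by omega) (Finset.one_le_prod' fun j _ => by omega)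

/-- `1 ≤ PmaxS₂`. [folklore] -/
theorem one_le_PmaxS₂ : (1 : ℤ) ≤ S.PmaxS₂ Sc := by
  unfold PmaxS₂
  refine Int.one_le_ceil_iff.mpr ?_
  have hU : (1 : ℝ) ≤ S.UcardS₂ Sc := by exact_mod_cast S.one_le_UcardS₂_aux Sc
  have hA := S.one_le_AmaxS₂ Sc
  nlinarith

/-! ### Slot ceilings of the closed forms (logarithms; `ν(H)` symbolic) -/

omit [Fact p.Prime] S in
/-- **`log M0C ≤ log 2 + (Ŝ−lev)·t₀·log 2 + t₀·log ν(H) + H/e + L₀·(1 + log(1 + 2^{Ŝ−lev}|x|/H))`.** [cite: Nesterenko2003, (3.8), (4.20); shape only] -/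
theorem log_M0C_le' (L₀ H Sh lev : ℕ) (x : ℤ) (t₀ : ℕ) :
    Real.log (M0C L₀ H Sh lev x t₀ : ℝ) ≤ Real.log 2 + ((Sh - lev) * t₀ : ℕ) * Real.log 2 + t₀ * Real.log (Nat.lcmUpto H : ℝ) + H / Real.exp 1 +
      L₀ * (1 + Real.log (1 + |((2 ^ (Sh - lev) * x : ℤ) : ℝ)| / H)) := by
  set A : ℝ := (2 : ℝ) ^ ((Sh - lev) * t₀) * ((Nat.lcmUpto H : ℝ) ^ t₀ *
    (Real.exp (H / Real.exp 1) * (Real.exp 1 * (1 + |((2 ^ (Sh - lev) * x : ℤ) : ℝ)| / H)) ^ L₀)) with hA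
  have hν : (0 : ℝ) < (Nat.lcmUpto H : ℝ) := by exact_mod_cast Nat.lcmUpto_pos H
  have hb0 : (0 : ℝ) < Real.exp 1 * (1 + |((2 ^ (Sh - lev) * x : ℤ) : ℝ)| / H) := by positivity
  have hb : (1 : ℝ) ≤ Real.exp 1 * (1 + |((2 ^ (Sh - lev) * x : ℤ) : ℝ)| / H) := by
    have : (1 : ℝ) ≤ Real.exp 1 := Real.one_le_exp zero_le_one
    have : (0 : ℝ) ≤ |((2 ^ (Sh - lev) * x : ℤ) : ℝ)| / H := by positivity
    nlinarith
  have hA1 : 1 ≤ A := by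
    have h2 : (1 : ℝ) ≤ (2 : ℝ) ^ ((Sh - lev) * t₀) := one_le_pow₀ (by norm_num)
    have h3 : (1 : ℝ) ≤ (Nat.lcmUpto H : ℝ) ^ t₀ := one_le_pow₀ (by exact_mod_cast Nat.lcmUpto_pos H)
    have h4 : (1 : ℝ) ≤ Real.exp (H / Real.exp 1) := Real.one_le_exp (by positivity)
    have h5 : (1 : ℝ) ≤ (Real.exp 1 * (1 + |((2 ^ (Sh - lev) * x : ℤ) : ℝ)| / H)) ^ L₀ := one_le_pow₀ hb
    exact one_le_mul_of_one_le_of_one_le h2 (one_le_mul_of_one_le_of_one_le h3 (one_le_mul_of_one_le_of_one_le h4 h5))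
  have hM : (M0C L₀ H Sh lev x t₀ : ℝ) ≤ 2 * A := by
    have h1 : (M0C L₀ H Sh lev x t₀ : ℝ) < A + 1 := by
      unfold M0C; rw [← hA]; exact_mod_cast Int.ceil_lt_add_one A
    linarith
  have hM0 : (0 : ℝ) < (M0C L₀ H Sh lev x t₀ : ℝ) := by exact_mod_cast lt_of_lt_of_le zero_lt_one (one_le_M0C_aux L₀ H Sh lev x t₀)
  have hlogA : Real.log A = ((Sh - lev) * t₀ : ℕ) * Real.log 2 + t₀ * Real.log (Nat.lcmUpto H : ℝ) + H / Real.exp 1 +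
      L₀ * (1 + Real.log (1 + |((2 ^ (Sh - lev) * x : ℤ) : ℝ)| / H)) := by
    rw [hA, Real.log_mul (by positivity) (by positivity), Real.log_pow, Real.log_mul (by positivity) (by positivity), Real.log_pow,
      Real.log_mul (by positivity) (by positivity), Real.log_exp, Real.log_pow, Real.log_mul (by positivity) (by positivity), Real.log_exp]
    push_cast; ring
  calc Real.log (M0C L₀ H Sh lev x t₀ : ℝ) ≤ Real.log (2 * A) := Real.log_le_log hM0 hM
    _ = Real.log 2 + Real.log A := Real.log_mul (by norm_num) (by positivity)
    _ = _ := by rw [hlogA]; ring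

/-- **`log KC ≤ log 2 + log U + log P + log M0C(lev, x, t₀) + |t|·log max(1, XbC L) + 2·log monDen(α, L|x|)`** for `U ≥ 1`, `P ≥ 1`.
[cite: Nesterenko2003, §4.2 (4.31); shape only] -/
theorem log_KC_le {U : ℕ} (hU : 1 ≤ U) {P : ℤ} (hP : 1 ≤ P) (L₀ H Sh lev : ℕ) (L : Fin S.n → ℕ) (x : ℤ) (τ : Tau S.n) :
    Real.log (S.KC U P L₀ H Sh lev L x τ) ≤ Real.log 2 + Real.log U + Real.log P + Real.log (M0C L₀ H Sh lev x τ.1 : ℝ) +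
      (∑ k, τ.2 k : ℕ) * Real.log (max 1 (S.XbC L : ℝ)) + 2 * Real.log (MonomialDen.monDen S.α (S.boxExpG L x) : ℝ) := by
  have hU' : (1 : ℝ) ≤ U := by exact_mod_cast hU
  have hP' : (1 : ℝ) ≤ P := by exact_mod_cast hP
  have hM : (1 : ℝ) ≤ (M0C L₀ H Sh lev x τ.1 : ℝ) := by exact_mod_cast one_le_M0C_aux L₀ H Sh lev x τ.1
  have hmon : (1 : ℝ) ≤ (MonomialDen.monDen S.α (S.boxExpG L x) : ℝ) := by exact_mod_cast MonomialDen.one_le_monDen _ S.α_ne _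
  have hX0 : (0 : ℝ) ≤ (S.XbC L : ℝ) := by
    have : (0 : ℤ) ≤ S.XbC L := by
      unfold XbC; exact mul_nonneg (by norm_num) (mul_nonneg (sum_nonneg fun j _ => abs_nonneg _) (sum_nonneg fun j _ => by positivity))
    exact_mod_cast this
  have hXm : (1 : ℝ) ≤ max 1 (S.XbC L : ℝ) := le_max_left _ _
  set Y : ℝ := (U : ℝ) * P * ((M0C L₀ H Sh lev x τ.1 : ℝ) * (max 1 (S.XbC L : ℝ)) ^ (∑ k, τ.2 k) *
    ((MonomialDen.monDen S.α (S.boxExpG L x) : ℝ)) ^ 2) with hY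
  have hY1 : 1 ≤ Y := by
    have h1 : (1 : ℝ) ≤ (M0C L₀ H Sh lev x τ.1 : ℝ) * (max 1 (S.XbC L : ℝ)) ^ (∑ k, τ.2 k) * ((MonomialDen.monDen S.α (S.boxExpG L x) : ℝ)) ^ 2 :=
      one_le_mul_of_one_le_of_one_le (one_le_mul_of_one_le_of_one_le hM (one_le_pow₀ hXm)) (one_le_pow₀ hmon)
    exact one_le_mul_of_one_le_of_one_le (one_le_mul_of_one_le_of_one_le hU' hP') h1
  have hKY : S.KC U P L₀ H Sh lev L x τ ≤ 2 * Y := by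
    unfold KC
    have hle : (U : ℝ) * P * ((M0C L₀ H Sh lev x τ.1 : ℝ) * (S.XbC L : ℝ) ^ (∑ k, τ.2 k) * ((MonomialDen.monDen S.α (S.boxExpG L x) : ℝ)) ^ 2) ≤ Y := by
      rw [hY]
      have hxp : (S.XbC L : ℝ) ^ (∑ k, τ.2 k) ≤ (max 1 (S.XbC L : ℝ)) ^ (∑ k, τ.2 k) := pow_le_pow_left₀ hX0 (le_max_right _ _) _
      have hM0 : (0 : ℝ) ≤ (M0C L₀ H Sh lev x τ.1 : ℝ) := le_trans zero_le_one hM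
      refine mul_le_mul_of_nonneg_left (mul_le_mul_of_nonneg_right (mul_le_mul_of_nonneg_left hxp hM0) (by positivity)) ?_
      exact mul_nonneg (le_trans zero_le_one hU') (le_trans zero_le_one hP')
    linarith
  have hK0 : 0 < S.KC U P L₀ H Sh lev L x τ := lt_of_lt_of_le zero_lt_one (S.one_le_KC U (le_trans zero_le_one hP) L₀ H Sh lev L x τ)
  have hlogY : Real.log Y = Real.log U + Real.log P + Real.log (M0C L₀ H Sh lev x τ.1 : ℝ) +
      (∑ k, τ.2 k : ℕ) * Real.log (max 1 (S.XbC L : ℝ)) + 2 * Real.log (MonomialDen.monDen S.α (S.boxExpG L x) : ℝ) := by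
    rw [hY, Real.log_mul (by positivity) (by positivity), Real.log_mul (by positivity) (by positivity),
      Real.log_mul (by positivity) (by positivity), Real.log_mul (by positivity) (by positivity), Real.log_pow, Real.log_pow]
    push_cast; ring
  calc Real.log (S.KC U P L₀ H Sh lev L x τ) ≤ Real.log (2 * Y) := Real.log_le_log hK0 hKY
    _ = Real.log 2 + Real.log Y := Real.log_mul (by norm_num) (by positivity)
    _ = _ := by rw [hlogY]; ring

/-- **`log(1 + U·P·MhCs) ≤ log 2 + log U + log P + t₀·log 2 + log M0C(lev+1, s₁, t₀) + |t|·log max(1, XbC L) + log halfHgtR`** for `U, P ≥ 1`.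
[cite: Nesterenko2003, §4.3 (4.41); shape only] -/
theorem log_one_add_UPMhCs_le {U : ℕ} (hU : 1 ≤ U) {P : ℤ} (hP : 1 ≤ P) (L : Fin S.n → ℕ) (L₀ H Sh lev : ℕ) (s₁ : ℤ) (τ : Tau S.n) :
    Real.log (1 + (U : ℝ) * P * S.MhCs L L₀ H Sh lev s₁ τ) ≤ Real.log 2 + Real.log U + Real.log P + τ.1 * Real.log 2 +
      Real.log (M0C L₀ H Sh (lev + 1) s₁ τ.1 : ℝ) + (∑ k, τ.2 k : ℕ) * Real.log (max 1 (S.XbC L : ℝ)) + Real.log (S.halfHgtR L s₁) := by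
  have hU' : (1 : ℝ) ≤ U := by exact_mod_cast hU
  have hP' : (1 : ℝ) ≤ P := by exact_mod_cast hP
  have hM : (1 : ℝ) ≤ (M0C L₀ H Sh (lev + 1) s₁ τ.1 : ℝ) := by exact_mod_cast one_le_M0C_aux L₀ H Sh (lev + 1) s₁ τ.1
  have hh : (1 : ℝ) ≤ S.halfHgtR L s₁ := S.one_le_halfHgtR L s₁
  have hX0 : (0 : ℝ) ≤ (S.XbC L : ℝ) := by
    have : (0 : ℤ) ≤ S.XbC L := by
      unfold XbC; exact mul_nonneg (by norm_num) (mul_nonneg (sum_nonneg fun j _ => abs_nonneg _) (sum_nonneg fun j _ => by positivity))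
    exact_mod_cast this
  have hXm : (1 : ℝ) ≤ max 1 (S.XbC L : ℝ) := le_max_left _ _
  set Y : ℝ := (U : ℝ) * P * ((2 : ℝ) ^ τ.1 * (M0C L₀ H Sh (lev + 1) s₁ τ.1 : ℝ) * (max 1 (S.XbC L : ℝ)) ^ (∑ k, τ.2 k) * S.halfHgtR L s₁) with hY
  have hY1 : 1 ≤ Y := by
    have h1 : (1 : ℝ) ≤ (2 : ℝ) ^ τ.1 * (M0C L₀ H Sh (lev + 1) s₁ τ.1 : ℝ) * (max 1 (S.XbC L : ℝ)) ^ (∑ k, τ.2 k) * S.halfHgtR L s₁ :=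
      one_le_mul_of_one_le_of_one_le (one_le_mul_of_one_le_of_one_le (one_le_mul_of_one_le_of_one_le (one_le_pow₀ (by norm_num)) hM)
        (one_le_pow₀ hXm)) hh
    exact one_le_mul_of_one_le_of_one_le (one_le_mul_of_one_le_of_one_le hU' hP') h1
  have hle : 1 + (U : ℝ) * P * S.MhCs L L₀ H Sh lev s₁ τ ≤ 2 * Y := by
    have : (U : ℝ) * P * S.MhCs L L₀ H Sh lev s₁ τ ≤ Y := by
      rw [hY]; unfold MhCs
      have hxp : (S.XbC L : ℝ) ^ (∑ k, τ.2 k) ≤ (max 1 (S.XbC L : ℝ)) ^ (∑ k, τ.2 k) := pow_le_pow_left₀ hX0 (le_max_right _ _) _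
      have hM0 : (0 : ℝ) ≤ (2 : ℝ) ^ τ.1 * (M0C L₀ H Sh (lev + 1) s₁ τ.1 : ℝ) := by have := le_trans zero_le_one hM; positivity
      refine mul_le_mul_of_nonneg_left (mul_le_mul_of_nonneg_right (mul_le_mul_of_nonneg_left hxp hM0) (le_trans zero_le_one hh)) ?_
      exact mul_nonneg (le_trans zero_le_one hU') (le_trans zero_le_one hP')
    linarith
  have hpos : 0 < 1 + (U : ℝ) * P * S.MhCs L L₀ H Sh lev s₁ τ := by
    have := S.MhCs_nonneg L L₀ H Sh lev s₁ τ
    have : (0 : ℝ) ≤ (U : ℝ) * P * S.MhCs L L₀ H Sh lev s₁ τ := by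
      have := le_trans zero_le_one hU'; have := le_trans zero_le_one hP'; positivity
    linarith
  have hlogY : Real.log Y = Real.log U + Real.log P + τ.1 * Real.log 2 + Real.log (M0C L₀ H Sh (lev + 1) s₁ τ.1 : ℝ) +
      (∑ k, τ.2 k : ℕ) * Real.log (max 1 (S.XbC L : ℝ)) + Real.log (S.halfHgtR L s₁) := by
    rw [hY, Real.log_mul (by positivity) (by positivity), Real.log_mul (by positivity) (by positivity),
      Real.log_mul (by positivity) (by positivity), Real.log_mul (by positivity) (by positivity),
      Real.log_mul (by positivity) (by positivity), Real.log_pow, Real.log_pow]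
    push_cast; ring
  calc Real.log (1 + (U : ℝ) * P * S.MhCs L L₀ H Sh lev s₁ τ) ≤ Real.log (2 * Y) := Real.log_le_log hpos hle
    _ = Real.log 2 + Real.log Y := Real.log_mul (by norm_num) (by positivity)
    _ = _ := by rw [hlogY]; ring

/-- **`log AmaxS₂ = log M0C(L₀,H,Ŝ,0,X₀,T₀) + T₀·log XbSS₂ + 2·log monDen(α, Lb side 0 · X₀)`** (`X₀ = NS 0 0`, `T₀ = TordS 0 0`).
[cite: Nesterenko2003, (3.26); shape only] -/
theorem log_AmaxS₂_eq :
    Real.log (S.AmaxS₂ Sc) = Real.log (M0C Sc.L₀ Sc.H Sc.Sd 0 (S.NS Sc 0 0 : ℤ) (S.TordS Sc 0 0) : ℝ) +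
      (S.TordS Sc 0 0 : ℕ) * Real.log (S.XbSS₂ Sc : ℝ) +
      2 * Real.log (MonomialDen.monDen S.α (S.boxExpG (S.Lb (S.sideS₂ Sc) 0) (S.NS Sc 0 0 : ℤ)) : ℝ) := by
  have hM : (1 : ℝ) ≤ (M0C Sc.L₀ Sc.H Sc.Sd 0 (S.NS Sc 0 0 : ℤ) (S.TordS Sc 0 0) : ℝ) := by exact_mod_cast one_le_M0C_aux _ _ _ _ _ _
  have hX : (1 : ℝ) ≤ (S.XbSS₂ Sc : ℝ) := by unfold XbSS₂; exact_mod_cast le_max_left _ _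
  have hmon : (1 : ℝ) ≤ (MonomialDen.monDen S.α (S.boxExpG (S.Lb (S.sideS₂ Sc) 0) (S.NS Sc 0 0 : ℤ)) : ℝ) := by
    exact_mod_cast MonomialDen.one_le_monDen _ S.α_ne _
  unfold AmaxS₂
  rw [Real.log_mul (by positivity) (by positivity), Real.log_mul (by positivity) (by positivity), Real.log_pow, Real.log_pow]
  push_cast; ring

/-- `XbSS₂ = max 1 (XbC (Lb side₂ 0))` as a real. [folklore] -/
theorem XbSS₂_cast : (S.XbSS₂ Sc : ℝ) = max 1 (S.XbC (S.Lb (S.sideS₂ Sc) 0) : ℝ) := by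
  unfold XbSS₂; push_cast; rfl

/-- **`log PmaxS₂ ≤ log 2 + log UcardS₂ + log AmaxS₂`.** [folklore] -/
theorem log_PmaxS₂_le : Real.log (S.PmaxS₂ Sc : ℝ) ≤ Real.log 2 + Real.log (S.UcardS₂ Sc : ℝ) + Real.log (S.AmaxS₂ Sc) := by
  have hU : (1 : ℝ) ≤ S.UcardS₂ Sc := by exact_mod_cast S.one_le_UcardS₂_aux Sc
  have hA := S.one_le_AmaxS₂ Sc
  have hUA : 1 ≤ (S.UcardS₂ Sc : ℝ) * S.AmaxS₂ Sc := one_le_mul_of_one_le_of_one_le hU hA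
  have hP : (S.PmaxS₂ Sc : ℝ) ≤ 2 * ((S.UcardS₂ Sc : ℝ) * S.AmaxS₂ Sc) := by
    have h1 : (S.PmaxS₂ Sc : ℝ) < (S.UcardS₂ Sc : ℝ) * S.AmaxS₂ Sc + 1 := by
      unfold PmaxS₂; exact_mod_cast Int.ceil_lt_add_one _
    linarith
  have hP1 : (0 : ℝ) < (S.PmaxS₂ Sc : ℝ) := by exact_mod_cast lt_of_lt_of_le zero_lt_one (S.one_le_PmaxS₂ Sc)
  calc Real.log (S.PmaxS₂ Sc : ℝ) ≤ Real.log (2 * ((S.UcardS₂ Sc : ℝ) * S.AmaxS₂ Sc)) := Real.log_le_log hP1 hP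
    _ = Real.log 2 + Real.log (S.UcardS₂ Sc : ℝ) + Real.log (S.AmaxS₂ Sc) := by
        rw [Real.log_mul (by norm_num) (by positivity), Real.log_mul (by positivity) (by positivity)]; ring

/-- **`log UcardS₂ = log(L₀+1) + Σⱼ log(2·side₂ⱼ + 1)`.** [folklore] -/
theorem log_UcardS₂_eq : Real.log (S.UcardS₂ Sc : ℝ) = Real.log ((Sc.L₀ : ℝ) + 1) + ∑ j, Real.log (2 * (S.sideS₂ Sc j : ℝ) + 1) := by
  unfold UcardS₂
  push_cast
  rw [Real.log_mul (by positivity) (Finset.prod_pos fun j _ => by positivity).ne', Real.log_prod (s := Finset.univ) (fun j _ => by positivity)]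

/-- `2·side₂ⱼ + 1 ≤ Lbox/Aⱼ + 1`. [folklore] -/
theorem two_sideS₂_add_one_le (hL : 0 ≤ Sc.Lbox) (j : Fin S.n) : 2 * (S.sideS₂ Sc j : ℝ) + 1 ≤ Sc.Lbox / Sc.A j + 1 := by
  have hA := Sc.hA j
  have h : (S.sideS₂ Sc j : ℝ) ≤ Sc.Lbox / (2 * Sc.A j) := by unfold sideS₂; exact Nat.floor_le (by positivity)
  have : 2 * (Sc.Lbox / (2 * Sc.A j)) = Sc.Lbox / Sc.A j := by field_simp
  linarith

/-- **`log max(1, XbC L) ≤ log 2 + log n + W + log max(1, Σⱼ Lⱼ)`** from `log max(3,|bⱼ|) ≤ W` (`n ≥ 1`). [folklore] -/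
theorem log_max_one_XbC_le (hn : 1 ≤ S.n) {W : ℝ} (hWb : ∀ j, Real.log (max 3 (|S.b j| : ℝ)) ≤ W) (L : Fin S.n → ℕ) :
    Real.log (max 1 (S.XbC L : ℝ)) ≤ Real.log 2 + Real.log S.n + W + Real.log (max 1 (∑ j, (L j : ℝ))) := by
  have hX := S.XbC_le hWb L
  have hn' : (1 : ℝ) ≤ S.n := by exact_mod_cast hn
  have hW0 : 0 ≤ W := le_trans (Real.log_nonneg (le_max_left _ _ |>.trans' (by norm_num))) (hWb S.j₀)
  have hsum : (∑ j, (L j : ℝ)) ≤ max 1 (∑ j, (L j : ℝ)) := le_max_right _ _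
  have hB : (S.XbC L : ℝ) ≤ 2 * S.n * Real.exp W * max 1 (∑ j, (L j : ℝ)) := hX.trans (mul_le_mul_of_nonneg_left hsum (by positivity))
  have hB1 : (1 : ℝ) ≤ 2 * S.n * Real.exp W * max 1 (∑ j, (L j : ℝ)) := by
    have h1 : (1 : ℝ) ≤ Real.exp W := Real.one_le_exp hW0
    have h2 : (1 : ℝ) ≤ max 1 (∑ j, (L j : ℝ)) := le_max_left _ _
    nlinarith [mul_nonneg (sub_nonneg.mpr h1) (sub_nonneg.mpr h2)]
  have hmax : max 1 (S.XbC L : ℝ) ≤ 2 * S.n * Real.exp W * max 1 (∑ j, (L j : ℝ)) := max_le hB1 hB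
  calc Real.log (max 1 (S.XbC L : ℝ)) ≤ Real.log (2 * S.n * Real.exp W * max 1 (∑ j, (L j : ℝ))) :=
        Real.log_le_log (lt_of_lt_of_le zero_lt_one (le_max_left _ _)) hmax
    _ = Real.log 2 + Real.log S.n + W + Real.log (max 1 (∑ j, (L j : ℝ))) := by
        rw [Real.log_mul (by positivity) (by positivity), Real.log_mul (by positivity) (by positivity),
          Real.log_mul (by positivity) (by positivity), Real.log_exp]

end G3Setup

end Summit.ABC.StewartYu

end
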